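import Summits.QuantumAdvantage.QuantumAdvantage.Theorems.CharDialColumnDialA2
import HarnessLib

/-!
# CharDial — the SYMMETRIC-BLOCK LAW (part A3): groups of cuts, the address split, the score by groups, fibres

Tree twin, part A3 (§3.2–3.4), of the decomp-qadv lens-5 g34 node `Theses/ColumnDial.lean`; imports part A2.  Cuts grouped by the number
`kappa` of block positions before them and the address split `walkExp = outside part + block part` (§3.2 `pre`, `kappa`, `eOut`,
`addr_split`); the score by groups (§3.3 `dset`, `grp`, `fired`, `eZ`, `dgrp`, `ringWinU_eq`, `decide_dgrp`, `card_dset_split`); fibres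
`Xf p S z μ`, base words and invariance of outputs / fired sets / outside addresses along a fibre (§3.4).
Kernel-checked, no `sorry`, no instances, no notation.  Memo: decomp-qadv-lens-5/g34/NODE-g34.md (§9 proof map, §10 land package); blueprint BLUEPRINT-g34.md.  Re-cut of the staged part A (e9ab60e3) at section boundaries (≤ 400 lines per file, every declaration docstringed); declaration bodies byte-identical.
-/

set_option autoImplicit false
set_option linter.dupNamespace false

namespace Summit.QuantumAdvantage.QuantumAdvantage.Theorems.ColumnDial

open Finset
open Summit.QuantumAdvantage.AdviceFreeQNC0

section Law

variable {n : ℕ}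

/-! #### 3.2 cuts grouped by the number of block positions before them; the address split -/

/-- block positions strictly before the cut `g`. -/
def pre (S : Finset (Fin n)) (g : Fin (n + 1)) : Finset (Fin n) := S.filter fun s => s.val < g.val

/-- the group index of a cut: how many block positions precede it. -/
def kappa (S : Finset (Fin n)) (g : Fin (n + 1)) : ℕ := (pre S g).card

/-- Membership in `pre S g`: the block positions strictly before the cut `g`. -/
theorem mem_pre {S : Finset (Fin n)} {g : Fin (n + 1)} {s : Fin n} : s ∈ pre S g ↔ s ∈ S ∧ s.val < g.val := by
  simp [pre]

/-- `pre S g ⊆ S`. -/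
theorem pre_subset (S : Finset (Fin n)) (g : Fin (n + 1)) : pre S g ⊆ S := Finset.filter_subset _ _

/-- At most `|S|` block positions precede a cut: `kappa S g ≤ |S|`. -/
theorem kappa_le (S : Finset (Fin n)) (g : Fin (n + 1)) : kappa S g ≤ S.card := Finset.card_le_card (pre_subset S g)

/-- `pre S g` is monotone in the position of the cut. -/
theorem pre_mono (S : Finset (Fin n)) {g g' : Fin (n + 1)} (h : g.val ≤ g'.val) : pre S g ⊆ pre S g' := by
  intro s hs
  rw [mem_pre] at hs ⊢
  exact ⟨hs.1, lt_of_lt_of_le hs.2 h⟩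

/-- initial segments of `S` of equal size coincide. -/
theorem pre_eq_of_kappa_eq (S : Finset (Fin n)) {g g' : Fin (n + 1)} (h : kappa S g = kappa S g') : pre S g = pre S g' := by
  unfold kappa at h
  rcases le_total g.val g'.val with hle | hle
  · exact Finset.eq_of_subset_of_card_le (pre_mono S hle) h.symm.le
  · exact (Finset.eq_of_subset_of_card_le (pre_mono S hle) h.le).symm

/-- No block position precedes the cut `0`. -/
theorem pre_zero (S : Finset (Fin n)) : pre S (0 : Fin (n + 1)) = ∅ := by
  ext s; simp [pre]

/-- Every block position precedes the last cut. -/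
theorem pre_last (S : Finset (Fin n)) : pre S (Fin.last n) = S := by
  ext s; simp [pre]

/-- `kappa S 0 = 0`. -/
theorem kappa_zero (S : Finset (Fin n)) : kappa S (0 : Fin (n + 1)) = 0 := by
  rw [kappa, pre_zero, Finset.card_empty]

/-- `kappa S (Fin.last n) = |S|`. -/
theorem kappa_last (S : Finset (Fin n)) : kappa S (Fin.last n) = S.card := by
  rw [kappa, pre_last]

/-- the OUTSIDE part of the address of cut `g` (depends on `u` only off `S`). -/
def eOut (c : ℕ) (S : Finset (Fin n)) (u : Fin n → Bool) (g : Fin (n + 1)) : ℕ :=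
  c + g.val + SubChar.bw (univ \ S) u + SubChar.bw ((univ.filter fun k : Fin n => k.val < g.val) \ S) u

/-- The outside part `eOut` of an address depends only on the bits off `S`. -/
theorem eOut_agree {c : ℕ} {S : Finset (Fin n)} {u u' : Fin n → Bool} (h : ∀ k, k ∉ S → u k = u' k)
    (g : Fin (n + 1)) : eOut c S u g = eOut c S u' g := by
  unfold eOut
  rw [SubChar.bw_congr (A := univ \ S) (u := u) (v := u') (fun k hk => h k (Finset.mem_sdiff.1 hk).2),
    SubChar.bw_congr (A := (univ.filter fun k : Fin n => k.val < g.val) \ S) (u := u) (v := u')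
      (fun k hk => h k (Finset.mem_sdiff.1 hk).2)]

/-- The Hamming weight is the block weight of the full block `univ`. -/
theorem wt_eq_bw_univ (u : Fin n → Bool) : wt u = SubChar.bw univ u := rfl

/-- ★ ADDRESS SPLIT: `c + g + walkExp u g = e_g(outside) + wt_S u + wt_{pre S g} u`. -/
theorem addr_split (c : ℕ) (S : Finset (Fin n)) (u : Fin n → Bool) (g : Fin (n + 1)) :
    c + g.val + walkExp u g.val = eOut c S u g + (SubChar.bw S u + SubChar.bw (pre S g) u) := by
  have hsub : pre S g ⊆ (univ.filter fun k : Fin n => k.val < g.val) := by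
    intro s hs
    rw [mem_pre] at hs
    exact Finset.mem_filter.2 ⟨Finset.mem_univ _, hs.2⟩
  have hsd : (univ.filter fun k : Fin n => k.val < g.val) \ pre S g = (univ.filter fun k : Fin n => k.val < g.val) \ S := by
    ext k
    simp only [pre, Finset.mem_sdiff, Finset.mem_filter, Finset.mem_univ, true_and]
    tauto
  unfold walkExp eOut
  rw [wtPrefix_eq_bw, wt_eq_bw_univ, ShearDial.bw_eq_add_sdiff (Finset.subset_univ S) u, ShearDial.bw_eq_add_sdiff hsub u, hsd]
  ring

/-! #### 3.3 the score by groups -/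

/-- the scoring cuts of `u`. -/
def dset (c : ℕ) (y : Fin (n + 1) → (Fin n → Bool) → Bool) (u : Fin n → Bool) : Finset (Fin (n + 1)) :=
  univ.filter fun g => y g u = true ∧ (c + g.val + walkExp u g.val) % 3 ≠ 0

/-- The win bit is the parity of the number of fired cuts with a dissonant address (`dset`). -/
theorem ringWinU_eq (c : ℕ) (y : Fin (n + 1) → (Fin n → Bool) → Bool) (u : Fin n → Bool) :
    ringWinU c y u = decide ((dset c y u).card % 2 = 1) := rfl

/-- group `k`: cuts with exactly `k` block positions before them. -/
def grp (S : Finset (Fin n)) (k : ℕ) : Finset (Fin (n + 1)) := univ.filter fun g => kappa S g = k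

/-- fired cuts of group `k` at `u`. -/
def fired (S : Finset (Fin n)) (y : Fin (n + 1) → (Fin n → Bool) → Bool) (u : Fin n → Bool) (k : ℕ) :
    Finset (Fin (n + 1)) :=
  (grp S k).filter fun g => y g u = true

/-- outside offsets mod `3`. -/
def eZ (c : ℕ) (S : Finset (Fin n)) (u : Fin n → Bool) : Fin (n + 1) → ZMod 3 :=
  fun g => ((eOut c S u g : ℕ) : ZMod 3)

/-- the part of the score in group `k`. -/
def dgrp (c : ℕ) (S : Finset (Fin n)) (y : Fin (n + 1) → (Fin n → Bool) → Bool) (u : Fin n → Bool) (k : ℕ) :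
    Finset (Fin (n + 1)) :=
  (dset c y u).filter fun g => kappa S g = k

/-- `A % 3 ≠ 0` iff the residue of `A` in `ZMod 3` is nonzero. -/
theorem mod_three_ne_zero_iff (A : ℕ) : A % 3 ≠ 0 ↔ ((A : ℕ) : ZMod 3) ≠ 0 := by
  have h := ZMod.natCast_eq_natCast_iff' A 0 3
  rw [Nat.cast_zero, Nat.zero_mod] at h
  rw [Ne, Ne, h]

/-- ★ the group-`k` score set is the fired set cut down by the phase condition at the COMMON shift `wt_S u + wt_{pre} u`
(any representative `g₀` of the group). -/
theorem dgrp_eq (c : ℕ) (S : Finset (Fin n)) (y : Fin (n + 1) → (Fin n → Bool) → Bool) (u : Fin n → Bool) {k : ℕ}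
    {g₀ : Fin (n + 1)} (hg₀ : kappa S g₀ = k) :
    dgrp c S y u k = (fired S y u k).filter fun g =>
      eZ c S u g + (((SubChar.bw S u + SubChar.bw (pre S g₀) u : ℕ)) : ZMod 3) ≠ 0 := by
  ext g
  simp only [dgrp, dset, fired, grp, eZ, Finset.mem_filter, Finset.mem_univ, true_and]
  constructor
  · rintro ⟨⟨hy, hA⟩, hk⟩
    refine ⟨⟨hk, hy⟩, ?_⟩
    rw [pre_eq_of_kappa_eq S (hg₀.trans hk.symm), ← Nat.cast_add, ← addr_split]
    exact (mod_three_ne_zero_iff _).1 hA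
  · rintro ⟨⟨hk, hy⟩, hA⟩
    refine ⟨⟨hy, ?_⟩, hk⟩
    rw [pre_eq_of_kappa_eq S (hg₀.trans hk.symm), ← Nat.cast_add, ← addr_split] at hA
    exact (mod_three_ne_zero_iff _).2 hA

/-- `Nat.bodd m` is the decision of `m % 2 = 1`. -/
theorem bodd_eq_decide (m : ℕ) : Nat.bodd m = decide (m % 2 = 1) := by
  rcases Nat.mod_two_eq_zero_or_one m with h | h
  · rw [h]
    have : Nat.bodd m = false := by
      have h2 := Nat.bodd_add_div2 m
      cases hb : Nat.bodd m
      · rfl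
      · rw [hb] at h2; simp at h2; omega
    rw [this]; decide
  · rw [h]
    have : Nat.bodd m = true := by
      have h2 := Nat.bodd_add_div2 m
      cases hb : Nat.bodd m
      · rw [hb] at h2; simp at h2; omega
      · rfl
    rw [this]; decide

/-- the PARITY of the group-`k` score is the phase pattern of the fired group at the common shift. -/
theorem decide_dgrp (c : ℕ) (S : Finset (Fin n)) (y : Fin (n + 1) → (Fin n → Bool) → Bool) (u : Fin n → Bool) {k : ℕ}
    {g₀ : Fin (n + 1)} (hg₀ : kappa S g₀ = k) :
    decide ((dgrp c S y u k).card % 2 = 1) =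
      phasePat (fired S y u k) (eZ c S u) ((((SubChar.bw S u + SubChar.bw (pre S g₀) u : ℕ)) : ZMod 3)) := by
  rw [dgrp_eq c S y u hg₀, phasePat, bodd_eq_decide]

/-- an empty group scores nothing. -/
theorem dgrp_eq_empty (c : ℕ) (S : Finset (Fin n)) (y : Fin (n + 1) → (Fin n → Bool) → Bool) (u : Fin n → Bool) {k : ℕ}
    (h : ∀ g : Fin (n + 1), kappa S g ≠ k) : dgrp c S y u k = ∅ := by
  rw [Finset.eq_empty_iff_forall_notMem]
  intro g hg
  exact h g (Finset.mem_filter.1 hg).2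

/-- the score splits as outer group `0` + outer group `m` + inner groups. -/
theorem card_dset_split (c : ℕ) (S : Finset (Fin n)) (y : Fin (n + 1) → (Fin n → Bool) → Bool) (u : Fin n → Bool)
    (hm : 1 ≤ S.card) :
    (dset c y u).card = (dgrp c S y u 0).card + (dgrp c S y u S.card).card +
      ((dset c y u).filter fun g => kappa S g ≠ 0 ∧ kappa S g ≠ S.card).card := by
  have h1 := Finset.card_filter_add_card_filter_not (s := dset c y u) (fun g => kappa S g = 0)
  have h2 := Finset.card_filter_add_card_filter_not (s := (dset c y u).filter fun g => ¬ kappa S g = 0)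
    (fun g => kappa S g = S.card)
  rw [Finset.filter_filter, Finset.filter_filter] at h2
  have h3 : ((dset c y u).filter fun g => ¬ kappa S g = 0 ∧ kappa S g = S.card) = dgrp c S y u S.card := by
    unfold dgrp
    refine Finset.filter_congr fun g _ => ⟨fun h => h.2, fun h => ⟨by omega, h⟩⟩
  rw [h3] at h2
  have h4 : ((dset c y u).filter fun g => ¬ kappa S g = 0 ∧ ¬ kappa S g = S.card) =
      ((dset c y u).filter fun g => kappa S g ≠ 0 ∧ kappa S g ≠ S.card) := rfl
  rw [h4] at h2
  unfold dgrp at h2 ⊢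
  omega

/-- the inner part of the score is EVEN when every inner group has even score. -/
theorem inner_even (c : ℕ) (S : Finset (Fin n)) (y : Fin (n + 1) → (Fin n → Bool) → Bool) (u : Fin n → Bool)
    (h : ∀ k, 1 ≤ k → k < S.card → (dgrp c S y u k).card % 2 = 0) :
    ((dset c y u).filter fun g => kappa S g ≠ 0 ∧ kappa S g ≠ S.card).card % 2 = 0 := by
  set D := (dset c y u).filter fun g => kappa S g ≠ 0 ∧ kappa S g ≠ S.card
  have hD : D.card = ∑ k ∈ (range (S.card + 1)).filter (fun k => k ≠ 0 ∧ k ≠ S.card),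
      (D.filter fun g => kappa S g = k).card := by
    refine Finset.card_eq_sum_card_fiberwise fun g hg => ?_
    have hg' := (Finset.mem_filter.1 hg).2
    exact Finset.mem_filter.2 ⟨Finset.mem_range.2 (Nat.lt_succ_of_le (kappa_le S g)), hg'⟩
  have hterm : ∀ k ∈ (range (S.card + 1)).filter (fun k => k ≠ 0 ∧ k ≠ S.card),
      (D.filter fun g => kappa S g = k).card % 2 = 0 := by
    intro k hk
    rw [Finset.mem_filter, Finset.mem_range] at hk
    have hDk : (D.filter fun g => kappa S g = k) = dgrp c S y u k := by
      ext g
      simp only [D, dgrp, Finset.mem_filter]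
      constructor
      · rintro ⟨⟨hg, _⟩, hk'⟩; exact ⟨hg, hk'⟩
      · rintro ⟨hg, hk'⟩; exact ⟨⟨hg, by rw [hk']; exact hk.2⟩, hk'⟩
    rw [hDk]
    exact h k (by omega) (by omega)
  rw [hD, Finset.sum_nat_mod, Finset.sum_eq_zero hterm]
  decide

/-- The dissonant fired cuts split by groups: `|dset| = ∑ k ≤ |S|, |dgrp k|`. -/
theorem card_dset_eq_sum (c : ℕ) (S : Finset (Fin n)) (y : Fin (n + 1) → (Fin n → Bool) → Bool) (u : Fin n → Bool) :
    (dset c y u).card = ∑ k ∈ range (S.card + 1), (dgrp c S y u k).card :=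
  Finset.card_eq_sum_card_fiberwise fun g _ => Finset.mem_range.2 (Nat.lt_succ_of_le (kappa_le S g))

/-! #### 3.4 fibres, base words, invariance of the fired sets -/

/-- base words: vanish on the block. -/
def baseSet (S : Finset (Fin n)) : Finset (Fin n → Bool) := univ.filter fun z => ∀ k ∈ S, z k = false

/-- the fibre `X(z, μ)`: words over `z` with block weight `≡ μ (mod p)`. -/
def Xf (p : ℕ) (S : Finset (Fin n)) (z : Fin n → Bool) (μ : ZMod p) : Finset (Fin n → Bool) :=
  (fib S z).filter fun u => ((SubChar.bw S u : ℕ) : ZMod p) = μ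

/-- Membership in the class `Xf p S z μ`: in the fibre of `z`, with block weight `≡ μ (mod p)`. -/
theorem mem_Xf {p : ℕ} {S : Finset (Fin n)} {z : Fin n → Bool} {μ : ZMod p} {u : Fin n → Bool} :
    u ∈ Xf p S z μ ↔ u ∈ fib S z ∧ ((SubChar.bw S u : ℕ) : ZMod p) = μ := Finset.mem_filter

/-- Two elements of the same fibre agree off the block. -/
theorem agree_of_mem_fib {S : Finset (Fin n)} {z u u' : Fin n → Bool} (hu : u ∈ fib S z) (hu' : u' ∈ fib S z) :
    ∀ k, k ∉ S → u k = u' k :=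
  fun k hk => ((mem_fib.1 hu) k hk).trans ((mem_fib.1 hu') k hk).symm

/-- On a symmetric block mod `p`, every cut output is constant along a class `Xf p S z μ`. -/
theorem y_eq_of_mem_Xf {p : ℕ} {S : Finset (Fin n)} {y : Fin (n + 1) → (Fin n → Bool) → Bool} (hS : SymBlock p S y)
    {z : Fin n → Bool} {μ : ZMod p} {u u' : Fin n → Bool} (hu : u ∈ Xf p S z μ) (hu' : u' ∈ Xf p S z μ)
    (g : Fin (n + 1)) : y g u = y g u' :=
  hS g u u' (agree_of_mem_fib (mem_Xf.1 hu).1 (mem_Xf.1 hu').1) (by rw [(mem_Xf.1 hu).2, (mem_Xf.1 hu').2])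

/-- On a symmetric block mod `p`, the fired cuts of every group are constant along a class `Xf p S z μ`. -/
theorem fired_eq_of_mem_Xf {p : ℕ} {S : Finset (Fin n)} {y : Fin (n + 1) → (Fin n → Bool) → Bool} (hS : SymBlock p S y)
    {z : Fin n → Bool} {μ : ZMod p} {u u' : Fin n → Bool} (hu : u ∈ Xf p S z μ) (hu' : u' ∈ Xf p S z μ) (k : ℕ) :
    fired S y u k = fired S y u' k := by
  unfold fired
  exact Finset.filter_congr fun g _ => by rw [y_eq_of_mem_Xf hS hu hu' g]

/-- The outside address function `eZ` is constant along a fibre. -/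
theorem eZ_eq_of_mem_fib {c : ℕ} {S : Finset (Fin n)} {z u u' : Fin n → Bool} (hu : u ∈ fib S z) (hu' : u' ∈ fib S z) :
    eZ c S u = eZ c S u' := by
  funext g
  unfold eZ
  rw [eOut_agree (agree_of_mem_fib hu hu') g]

end Law

end Summit.QuantumAdvantage.QuantumAdvantage.Theorems.ColumnDial
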